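import Summits.HodgeConjecture.HodgeConjecture.Theorems.H413SpectrumOrthogonality
import Summits.HodgeConjecture.HodgeConjecture.Theorems.F0P3HilbertProjection
import Mathlib.Analysis.InnerProductSpace.Projection.Submodule
import HarnessLib

/-!
# FLOOR-0 P3 — multiplicity `≤ 1` AT ONE IRREDUCIBLE CLASS suffices: the per-class forms of «multiplicity one ⇒ equivalent
# irreducible closed subrepresentations coincide ⇒ distinct ones are orthogonal ⇒ a class detected only by `Π₀` lies in `Π₀`»

Cell hodgecm-mathlib, FLOOR 0, crux item H413 = stmt-HodgeConjecture-24833; E2′∕E1 dossier `F0/P3/p03/E2PRIME-RUNG2.md` §3 OBSERVATION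
(«E1_coh refold», F0P3-p03 (g3)).  PROOF lane (no `def`), GENERIC (any unitary representation on a Hilbert space ∕ any adelic
group datum).  Every consumer of the ENGINE letter E1 ★ `Rogawski1990.innerFormMultiplicityLeOne` in row III-J3a (★ `F0P3StubS3Fold`
∕ `F0P3StubS4Fold` via `mem_space_of_forall_detected_eq`, ★ `F0P3SphericalOfHolType.eq_of_areUnitarilyEquivalent_of_innerFormMultiplicityLeOne`,
the E1′h head) uses the GLOBAL `HasMultiplicityOne (𝒢.rightRegular μ)` only at ONE H¹-cohomological discrete `Π₀`; the tree's proof of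
★ `hasMultiplicityOne_iff_multiplicity_le_one_holds` ([HilbertRepSpectrumProofs] ll. 410–447) uses its hypothesis only as
«`multiplicity π W ≤ 1`» for THAT `W`.  This file records the per-class statements with the same proofs, so that E1 may be weakened to
«`multiplicity ≤ 1` for COHOMOLOGICAL `P`» (E1_coh = [Rogawski1990, Thm. 13.3.6 (c) + Thm. 14.6.4] alone, no Prop. 14.6.2 ∕ Thm. 14.6.5)
in every fold:
* §1 `eq_of_areUnitarilyEquivalent_of_multiplicity_le_one` — unitary `π`, `W` irreducible closed with `multiplicity π W ≤ 1`, `W′`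
  irreducible closed unitarily equivalent to `W` ⇒ `W = W′` (the isometric part of `P_{Wᗮ}|_{W′}`, ★
  `ClosedSubrep.exists_le_orthogonal_areUnitarilyEquivalent`, would give an orthogonal pair of copies);
  `isOrtho_of_ne_of_multiplicity_le_one` — then every OTHER irreducible closed `W′ ≠ W` is orthogonal to `W` (★ `isOrtho_of_ne`'s proof).
* §2 for discrete automorphic representations (★ `AutomorphicSpectrum`): `eq_of_areUnitarilyEquivalent_space_of_multiplicity_le_one`,
  `isOrtho_space_of_ne_of_multiplicity_le_one`, and `mem_space_of_forall_detected_eq_of_multiplicity_le_one` (★ `F0P3StubS3Fold`'s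
  «all projections but THE `Π₀` vanish ⇒ the class lies in `Π₀`», with `HasMultiplicityOne` replaced by `multiplicity … Π₀ ≤ 1`).
References: Dixmier 1977, §5.4, §13.1 [Dixmier1977]; Deitmar–Echterhoff 2014, Cor. 6.1.9 [DeitmarEchterhoff2014]; Borel–Jacquet 1979, §4.6
[BorelJacquet1979]; Rogawski 1990, Thm. 13.3.6 (c), Thm. 14.6.4 [Rogawski1990].
HONEST LABEL: HC_CM is proved only modulo the printed citations until rung 0 closes; this file discharges none of them.
-/

set_option autoImplicit false
set_option linter.dupNamespace false

noncomputable section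

namespace Summit.HodgeConjecture.HodgeConjecture.Cruxes.H413.F0P3MultiplicityLocal

open MeasureTheory NumberField Topology
open scoped InnerProductSpace
open Literature.NumberTheory.Automorphic
open Summit.HodgeConjecture.HodgeConjecture.Cruxes.H413.SpectrumJunction (space_injective)
open Summit.HodgeConjecture.HodgeConjecture.Cruxes.H413.F0P3HilbertProjection (exists_irreducible_not_orthogonal)

/-! ## §1 Unitary representations: multiplicity `≤ 1` at one irreducible class -/

section Unitary

variable {G H : Type*} [Group G] [NormedAddCommGroup H] [InnerProductSpace ℂ H] [CompleteSpace H]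
  {π : ContRepresentation ℂ G H}

/-- **Multiplicity `≤ 1` at the class of `W` ⇒ every irreducible closed subrepresentation unitarily equivalent to `W` IS `W`.**
(If `W′ ≰ W` — else `W′ = W` by irreducibility — the isometric part of the compressed projection `P_{Wᗮ}|_{W′}` gives an irreducible
`W″ ≤ Wᗮ` equivalent to `W′ ≃ W`, and the orthogonal pair `{W, W″}` has two members: multiplicity `≥ 2`.)  The per-class form of ★
`hasMultiplicityOne_iff_multiplicity_le_one_holds` (`←`), same proof. [cite: Dixmier1977, §5.4] [cite: DeitmarEchterhoff2014, Cor. 6.1.9] -/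
theorem eq_of_areUnitarilyEquivalent_of_multiplicity_le_one (hπ : π.IsUnitary) {W W' : ContRepresentation.ClosedSubrep π}
    (hW : W.toContRep.IsTopIrreducible) (hW' : W'.toContRep.IsTopIrreducible) (hm : π.multiplicity W.toContRep ≤ 1)
    (he : ContRepresentation.AreUnitarilyEquivalent W.toContRep W'.toContRep) : W = W' := by
  classical
  by_cases hle : W' ≤ W
  · exact (ContRepresentation.ClosedSubrep.eq_of_le_of_isTopIrreducible hW
      ((ContRepresentation.isTopIrreducible_iff _).mp hW').1 hle).symm
  · exfalso
    obtain ⟨W'', hW''le, hW''e⟩ :=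
      ContRepresentation.ClosedSubrep.exists_le_orthogonal_areUnitarilyEquivalent hπ W W' hW' hle
    have hW''W : ContRepresentation.AreUnitarilyEquivalent W''.toContRep W.toContRep := hW''e.symm.trans he.symm
    obtain ⟨e'', -⟩ := hW''e
    have hW''irr : W''.toContRep.IsTopIrreducible := (ContRepresentation.isTopIrreducible_congr e'').mp hW'
    have horth : W.toSubmodule ⟂ W''.toSubmodule := (Submodule.isOrtho_orthogonal_right W.toSubmodule).mono_right hW''le
    have hne : W ≠ W'' := by
      intro hWW
      rw [← hWW, Submodule.isOrtho_self] at horth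
      have hnt : Nontrivial W.toSubmodule := ((ContRepresentation.isTopIrreducible_iff _).mp hW).1
      exact (Submodule.nontrivial_iff_ne_bot.mp hnt) horth
    -- the orthogonal pair `{W, W″}` of copies of `W` is bounded by the multiplicity of `W`
    have hcard : ((({W, W''} : Finset (ContRepresentation.ClosedSubrep π)).card : ℕ) : ℕ∞) ≤ 1 := by
      refine le_trans ?_ hm
      unfold ContRepresentation.multiplicity
      refine le_iSup_of_le {W, W''} (le_iSup_of_le ?_ (le_iSup_of_le ?_ le_rfl))
      · intro X hX
        rw [Finset.mem_insert, Finset.mem_singleton] at hX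
        rcases hX with rfl | rfl
        · exact ⟨hW, ContRepresentation.AreUnitarilyEquivalent.refl _⟩
        · exact ⟨hW''irr, hW''W⟩
      · rw [Finset.coe_pair, Set.pairwise_pair]
        exact fun _ => ⟨horth, horth.symm⟩
    have hcard' : ({W, W''} : Finset (ContRepresentation.ClosedSubrep π)).card ≤ 1 := by exact_mod_cast hcard
    exact hne (Finset.card_le_one.mp hcard' W (by simp) W'' (by simp))

/-- **Multiplicity `≤ 1` at the class of `W` ⇒ every OTHER irreducible closed subrepresentation is orthogonal to `W`** (if
`W′ ≰ Wᗮ`, the isometric part of `P_{Wᗮᗮ}|_{W′}` puts an irreducible copy of `W′` inside `Wᗮᗮ = W`, which is `W`; so `W′ ≃ W`, so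
`W′ = W` by §1).  The per-class form of ★ `SpectrumJunction.isOrtho_of_ne`, same proof. [cite: Dixmier1977, §5.4]
[cite: DeitmarEchterhoff2014, Cor. 6.1.9] -/
theorem isOrtho_of_ne_of_multiplicity_le_one (hπ : π.IsUnitary) {W W' : ContRepresentation.ClosedSubrep π}
    (hW : W.toContRep.IsTopIrreducible) (hW' : W'.toContRep.IsTopIrreducible) (hm : π.multiplicity W.toContRep ≤ 1)
    (hne : W ≠ W') : W.toSubmodule ⟂ W'.toSubmodule := by
  suffices hle : W' ≤ W.orthogonal hπ from
    (Submodule.isOrtho_orthogonal_right W.toSubmodule).mono_right hle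
  by_contra hle
  obtain ⟨W'', hW''le, hW''e⟩ :=
    ContRepresentation.ClosedSubrep.exists_le_orthogonal_areUnitarilyEquivalent hπ (W.orthogonal hπ) W' hW' hle
  rw [ContRepresentation.ClosedSubrep.orthogonal_orthogonal] at hW''le
  obtain ⟨e'', -⟩ := id hW''e
  have hW''irr : W''.toContRep.IsTopIrreducible := (ContRepresentation.isTopIrreducible_congr e'').mp hW'
  have hW''eq : W'' = W := ContRepresentation.ClosedSubrep.eq_of_le_of_isTopIrreducible hW
    ((ContRepresentation.isTopIrreducible_iff _).mp hW''irr).1 hW''le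
  subst hW''eq
  exact hne (eq_of_areUnitarilyEquivalent_of_multiplicity_le_one hπ hW hW' hm hW''e.symm)

end Unitary

/-! ## §2 Discrete automorphic representations: the same at one discrete `Π₀` -/

section Discrete

variable {K : Type} [Field K] [NumberField K] {𝒢 : AdelicGroupData.{0} K}
  {μ : Measure 𝒢.automorphicQuotient} [SMulInvariantMeasure 𝒢.Adelic 𝒢.automorphicQuotient μ]

/-- **A discrete automorphic `Π₀` of multiplicity `≤ 1` equals every discrete `Π` unitarily equivalent to it** (★
`isUnitary_rightRegular`, §1, ★ `space_injective`). [cite: Dixmier1977, §5.4] [cite: BorelJacquet1979, §4.6] -/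
theorem eq_of_areUnitarilyEquivalent_space_of_multiplicity_le_one {P₀ P : DiscreteAutomorphicRep 𝒢 μ}
    (hm : (𝒢.rightRegular μ).multiplicity P₀.space.toContRep ≤ 1)
    (he : ContRepresentation.AreUnitarilyEquivalent P₀.space.toContRep P.space.toContRep) : P₀ = P :=
  space_injective (eq_of_areUnitarilyEquivalent_of_multiplicity_le_one (𝒢.isUnitary_rightRegular μ) P₀.irreducible
    P.irreducible hm he)

/-- **A discrete automorphic `Π₀` of multiplicity `≤ 1` is orthogonal to every other discrete `Π ≠ Π₀`.**
[cite: Dixmier1977, §5.4] [cite: BorelJacquet1979, §4.6] -/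
theorem isOrtho_space_of_ne_of_multiplicity_le_one {P₀ P : DiscreteAutomorphicRep 𝒢 μ}
    (hm : (𝒢.rightRegular μ).multiplicity P₀.space.toContRep ≤ 1) (hne : P₀ ≠ P) :
    P₀.space.toSubmodule ⟂ P.space.toSubmodule :=
  isOrtho_of_ne_of_multiplicity_le_one (𝒢.isUnitary_rightRegular μ) P₀.irreducible P.irreducible hm
    fun h => hne (space_injective h)

/-- **«All projections but THE `Π₀` vanish ⇒ the class lies in `Π₀`», needing multiplicity `≤ 1` only at `Π₀`.**  In a discretely
decomposable `L²(G(K)\G(𝔸_K), μ)`, if the discrete `Π₀` has multiplicity `≤ 1` and EVERY discrete `Π` not orthogonal to `v` equals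
`Π₀`, then `v ∈ Π₀` (the component `v − pr_{Π₀} v ∈ Π₀ᗮ`, if non-zero, meets some irreducible closed `Π` (★ `exists_irreducible_not_orthogonal`);
`Π ≠ Π₀`, so `Π ⟂ Π₀` by `isOrtho_space_of_ne_of_multiplicity_le_one` and `Π` meets `v` itself — contradiction).  The per-class form of
★ `F0P3StubS3Fold.mem_space_of_forall_detected_eq`. [cite: Dixmier1977, §5.4 and §13.1] [cite: BorelJacquet1979, §4.6] -/
theorem mem_space_of_forall_detected_eq_of_multiplicity_le_one (hdisc : (𝒢.rightRegular μ).IsDiscretelyDecomposable)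
    (P₀ : DiscreteAutomorphicRep 𝒢 μ) (hm : (𝒢.rightRegular μ).multiplicity P₀.space.toContRep ≤ 1) (v : 𝒢.L2 μ)
    (huniq : ∀ P : DiscreteAutomorphicRep 𝒢 μ, (∃ u ∈ P.space, ⟪(u : 𝒢.L2 μ), v⟫_ℂ ≠ 0) → P = P₀) :
    v ∈ P₀.space.toSubmodule := by
  set p : 𝒢.L2 μ := (P₀.space.toSubmodule.orthogonalProjectionOnto v : 𝒢.L2 μ) with hp
  have hpmem : p ∈ P₀.space.toSubmodule := (P₀.space.toSubmodule.orthogonalProjectionOnto v).2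
  have hu_orth : v - p ∈ (P₀.space.toSubmodule)ᗮ := by
    rw [hp, ← Submodule.starProjection_apply]
    exact Submodule.sub_starProjection_mem_orthogonal v
  by_cases hu : v - p = 0
  · rw [sub_eq_zero] at hu
    rw [hu]
    exact hpmem
  · exfalso
    obtain ⟨Wc, hWirr, x, hx, hxu⟩ := exists_irreducible_not_orthogonal hdisc hu
    let P : DiscreteAutomorphicRep 𝒢 μ := ⟨Wc, hWirr⟩
    -- `P ≠ P₀`: `x ∈ P₀` would be orthogonal to `v - p ∈ P₀ᗮ`
    have hne : P ≠ P₀ := by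
      intro hPP
      have hx0 : x ∈ P₀.space.toSubmodule := by
        have : P.space = P₀.space := by rw [hPP]
        exact this ▸ hx
      exact hxu (Submodule.inner_right_of_mem_orthogonal hx0 hu_orth)
    -- `P₀ ⊥ P`, so `⟪x, p⟫ = 0` and `⟪x, v⟫ = ⟪x, v - p⟫ ≠ 0`
    have horth : P₀.space.toSubmodule ⟂ P.space.toSubmodule := isOrtho_space_of_ne_of_multiplicity_le_one hm (Ne.symm hne)
    have hxp : ⟪(x : 𝒢.L2 μ), p⟫_ℂ = 0 := horth.symm.inner_eq hx hpmem
    have hxv : ⟪(x : 𝒢.L2 μ), v⟫_ℂ ≠ 0 := by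
      have : ⟪(x : 𝒢.L2 μ), v⟫_ℂ = ⟪(x : 𝒢.L2 μ), v - p⟫_ℂ := by rw [inner_sub_right, hxp, sub_zero]
      rw [this]
      exact hxu
    exact hne (huniq P ⟨x, hx, hxv⟩)

end Discrete

end Summit.HodgeConjecture.HodgeConjecture.Cruxes.H413.F0P3MultiplicityLocal

end
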